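import Summits.QuantumFields.BalabanUV.Gaps.D4WalkModelFull
import Summits.QuantumFields.BalabanUV.T4Continuum.Spine.NE5.TwoRunTorusWalkParam

/-!
# Spine/NE5/TwoRunTorusWalkFullModel — on NODE O's FULL MODEL the σ-holomorphy input of the walk-record junction is
# free: `hPhol ∧ h226` for one term from a full-model walk record + NODE A's inputs + potentials (cell `pub-balaban-gaps`, seat `ne5` gen 9)

WHY.  T25 `TwoRunTorusWalkParam.hol_and_h226_torus_of_termWalkData_param` leaves, per term, six non-walk inputs; the
first of them — (i) entrywise σ-holomorphy of the record's kernels `𝒦.A2 σ b`, `𝒦.G2 σ b` on the open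
`e^{κ₁+1}`-polydisc — is STRUCTURAL whenever the kernels are (1.11)-shape local kernel families: a kernel
`K(σ,u) = Σ_b (∏_{j ∈ J_b} σ_j)·c_b(u)·M_b` (`B13LocalKernelWalks.LocalTerms.kernel`) is a POLYNOMIAL in σ, hence entire
(§1 `differentiable_localKernel_sigma`, any datum, any configuration).  NODE O's FULL MODEL term
(`Gaps/D4WalkModelFull.FullModelTerm`: Γ-slot `G.kernel`, precision `1 + H.kernel`, covariance by the Neumann step,
record `toKernels`) has exactly such kernels (§3, by `rfl`), and §2 `hol_and_h226_torus_of_localKernels_param` = T25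
for ANY record whose kernels are local families (`𝒦.A2 σ b = A₀ + H.kernel σ b`, `𝒦.G2 σ b = G.kernel σ b`) with
(i) DISCHARGED: what a full-model term still owes the (2.26)∕Cauchy layer is its walk
objects `TermWalkData (t.toKernels c⁺ hpos) w` (g1-p2's `FullModelTerm.termWalkData` in the seam direction `B = E`,
T19 `TwoRunPencilFullModel.termWalkData_pencil` along NE5's pencil `B = E × ℂ` — both land in this type), NODE A's
symmetry ∕ `Re ≻ 0` of `1 + H.kernel σ b` and `SmallTheta`, the potentials with (2.20), the common `χ` with (2.22), the
column fibre bound (x10), and the numerics.  §4 records the route for Bałaban's own family, whose kernels are INFINITE walk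
series (1.11) rather than finite local families: σ-holomorphy of the series from TERMWISE σ-holomorphy + the walk
majorants (`differentiableOn_sigma_of_hasSum`, g1-p2's Cauchy-estimate lemma on the sup-norm ball of the parameter
space) — the field a walk record would need to carry for (i) to be derived (located typing point (x12)).

HONEST FRAMING.  §1 is an elementary polynomial-differentiability fact; §2 is T25 specialised to a MODEL record of
NODE O (nothing of Bałaban's `C^{(k)}(Z₀,σ)`, `Γ_k(Z₀,σ)` is constructed or asserted; whether his kernels are such local
families with printed constants is NODE O's statement (v)); NE5 NOT PRINTED ∕ NOT PROVED; leaves 0∕12; (D4) 0∕1; spine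
0∕9.  Rung (B)+1 on a FIXED finite T⁴ — NOT continuum, NOT infinite volume, NOT mass gap, NOT Clay.  HONEST DEPENDENCY:
continuum YM on T⁴ ⇐ BetaPertH ∧ nine spine estimates; BetaPertH ⇐ (D1) ∧ (D4) ∧ CAP+tail.  0 sorry, 0 `def`.

Sources: [II] = T. Bałaban, CMP **116** (1988) [Balaban1988RG2Cluster] (1.11) p. 5, p. 13, (2.14)–(2.26) pp. 15–17;
[B9] = CMP **99** (1985) [Balaban1985BackgroundPropagators] (3.107) p. 416; C. King, CMP **102** (1986) [King1986] p. 665.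
-/

noncomputable section

namespace Summit.QuantumFields.BalabanUV.T4Continuum.Spine.NE5.TwoRunTorusWalkFullModel

open Matrix Metric Set Finset
open Literature.MathematicalPhysics.QuantumFieldTheory.Balaban1983to89
open Literature.MathematicalPhysics.QuantumFieldTheory.Balaban1983to89.TreeLengthTorus (TPt TDom tsys)
open Literature.MathematicalPhysics.QuantumFieldTheory.Balaban1983to89.TreeLengthTorusTransfer (tclosure)
open Literature.MathematicalPhysics.QuantumFieldTheory.Balaban1983to89.B13Lemma3TorusData (TBond)
open Literature.MathematicalPhysics.QuantumFieldTheory.Balaban1983to89.B13Lemma3TorusTerms (weight Z0)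
open Literature.MathematicalPhysics.QuantumFieldTheory.Balaban1983to89.B13Term214 (core214 F214 term214)
open Literature.MathematicalPhysics.QuantumFieldTheory.Balaban1983to89.B13Bound143 (invTau)
open Literature.MathematicalPhysics.QuantumFieldTheory.Balaban1983to89.B5TorusCover (UT)
open Literature.MathematicalPhysics.QuantumFieldTheory.Balaban1983to89.B13LocalKernelWalks (LocalTerms)
open Literature.MathematicalPhysics.QuantumFieldTheory.Balaban1983to89.B9SectDWalk (MajSumLe)
open Literature.MathematicalPhysics.QuantumFieldTheory.Balaban1983to89.B9Thm34Ext (toB6)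
open Literature.MathematicalPhysics.QuantumFieldTheory.Balaban1983to89.B9Thm37GlueTorus (torusGeom)
open Literature.MathematicalPhysics.QuantumFieldTheory.Balaban1983to89.B13ExpansionAnalytic (differentiableOn_of_hasSum)
open Literature.MathematicalPhysics.QuantumFieldTheory.Balaban1983to89.B13TermWalkData (WalkConsts TermKernels TermWalkData)
open Literature.MathematicalPhysics.QuantumFieldTheory.Balaban1983to89.B13TermWalkDataOneTorus (SmallTheta)
open Summit.QuantumFields.BalabanUV.Gaps.D4WalkModelFull (FullModelTerm)
open Summit.QuantumFields.BalabanUV.T4Continuum.Spine.NE5.TwoRunTorusWalkParam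
  (hol_and_h226_torus_of_termWalkData_param)

/-! ## §1. Local kernel families are entire in σ -/

section Sigma

variable {d N' : ℕ} [NeZero N'] {ν : ℕ} {Nf : Fin ν → ℕ} [∀ i, NeZero (Nf i)] {p n : Type}
variable {E : Type*} [NormedAddCommGroup E] [NormedSpace ℂ E]

/-- An `s`-monomial `σ ↦ ∏_{j ∈ J} σ_j` is an entire function of `σ`. [cite: Balaban1988RG2Cluster, (1.11) p.5] -/
theorem differentiable_monomial (J : Finset (TPt d N')) :
    Differentiable ℂ (fun σ : TPt d N' → ℂ => ∏ j ∈ J, σ j) := by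
  classical
  induction J using Finset.induction_on with
  | empty =>
    have h : (fun σ : TPt d N' → ℂ => ∏ j ∈ (∅ : Finset (TPt d N')), σ j) = fun _ => (1 : ℂ) := by
      funext σ; rw [Finset.prod_empty]
    rw [h]
    exact differentiable_const (1 : ℂ)
  | insert a s ha ih =>
    have h : (fun σ : TPt d N' → ℂ => ∏ j ∈ insert a s, σ j) = fun σ => σ a * ∏ j ∈ s, σ j := by
      funext σ; rw [Finset.prod_insert ha]
    rw [h]
    have h1 : Differentiable ℂ (fun σ : TPt d N' → ℂ => σ a) := differentiable_apply (𝕜 := ℂ) a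
    exact Differentiable.fun_mul (E := TPt d N' → ℂ) (𝔸 := ℂ) h1 ih

/-- **Every entry of a (1.11)∕(3.107)-shape local kernel family `K(σ,u) = Σ_b (∏_{j ∈ J_b} σ_j)·c_b(u)·M_b` is an ENTIRE
function of the decoupling parameters σ** (a polynomial), at every configuration `u`; in particular it is
`DifferentiableOn` on any σ-region — the input (i) of T25 for records whose kernels are local families.
[cite: Balaban1988RG2Cluster, (1.11) p.5, p.13; Balaban1985BackgroundPropagators, (3.107) p.416] -/
theorem differentiable_localKernel_sigma (L : LocalTerms d N' ν Nf p n E) (u : E) (i : p) (j : n) :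
    Differentiable ℂ (fun σ : TPt d N' → ℂ => L.kernel σ u i j) := by
  have h : (fun σ : TPt d N' → ℂ => L.kernel σ u i j) =
      fun σ => ∑ b, (∏ j' ∈ L.J b, σ j') * L.coef b u * L.M b i j := by
    funext σ; rw [LocalTerms.kernel_apply]; exact Finset.sum_congr rfl fun b _ => LocalTerms.term_apply L b σ u i j
  rw [h]
  refine Differentiable.fun_sum (E := TPt d N' → ℂ) (F := ℂ) fun b _ => ?_
  have h1 : Differentiable ℂ (fun σ : TPt d N' → ℂ => (∏ j' ∈ L.J b, σ j') * L.coef b u) :=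
    Differentiable.fun_mul (E := TPt d N' → ℂ) (𝔸 := ℂ) (differentiable_monomial (L.J b)) (differentiable_const _)
  exact Differentiable.fun_mul (E := TPt d N' → ℂ) (𝔸 := ℂ) h1 (differentiable_const _)

end Sigma

/-! ## §2. T25 for records whose kernels are local families: the σ-holomorphy input discharged -/

section Local

variable {d L N' : ℕ} [NeZero L] [NeZero N'] {M : ℕ}
variable {ν : ℕ} {Nf : Fin ν → ℕ} [∀ i, NeZero (Nf i)]
variable {B : Type*} [NormedAddCommGroup B] [NormedSpace ℂ B]

open Classical in
/-- **`hPhol` ∧ `h226` FOR ONE TERM FROM A WALK RECORD WHOSE KERNELS ARE LOCAL FAMILIES** (T25 with input (i)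
discharged).  Data as in T25 `hol_and_h226_torus_of_termWalkData_param` — ONE record `𝒦 : TermKernels c⁺ d N′ ν Nf B`
with `TermWalkData 𝒦 w`, `w.Admissible α Rσ₀`, `0 < α`, NODE A's symmetry ∕ `Re ≻ 0` and `SmallTheta w α θ`, the
potentials with (2.20), the common `χ, χᶜ, 𝐃` with (2.22), a column fibre bound, rates and numerics — EXCEPT that the two
σ-holomorphy binders `hAhol hGhol` are REPLACED by the structural datum «the record's kernels are (1.11)-shape local
families»: `𝒦.A2 σ b = A₀ + H.kernel σ b`, `𝒦.G2 σ b = G.kernel σ b` for a constant matrix `A₀` and local data `H`, `G`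
(§1 makes them entire in σ).  NODE O's FULL MODEL record `FullModelTerm.toKernels` has this shape with `A₀ = 1` (§3,
by `rfl`); its walk record is g1-p2's `FullModelTerm.termWalkData` (seam, `B = E`) ∕ T19
`TwoRunPencilFullModel.termWalkData_pencil` (NE5's pencil, `B = E × ℂ`), run at `c⁺`.  Conclusion = T25's.
[cite: Balaban1988RG2Cluster, (1.11) p.5, p.13, (2.14)–(2.16) pp.15–16, (2.20)–(2.26) pp.16–17; Balaban1985BackgroundPropagators, Thm 3.10 p.416; King1986, p.665] -/
theorem hol_and_h226_torus_of_localKernels_param (c : B13.Consts) (hκ₁ : 1 ≤ c.κ₁) (hα₆ : c.α₆ ≠ 0)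
    (Z : TDom d N') (t : Finset (TDom d (L * N')) × Finset (TBond d M (L * N')))
    (hpos : ∀ Y : TDom d (L * N'), 0 < invTau c ((tsys d (L * N')).dj Y))
    (hhalf : ∀ Y : TDom d (L * N'), invTau c ((tsys d (L * N')).dj Y) ≤ 1 / 2)
    {Uτ : TDom d (L * N') → Set ℂ} (hUτ : ∀ Y, IsOpen (Uτ Y))
    (hUtau : ∀ Y : TDom d (L * N'), closedBall (0 : ℂ) ((invTau c ((tsys d (L * N')).dj Y))⁻¹) ⊆ Uτ Y)
    {r : ℝ} (hr : 0 < r) (hr' : r ≤ Real.exp c.κ₁ - 1)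
    (hsubτ : ∀ Y, ∀ s ∈ Set.uIcc (0 : ℝ) 1, closedBall (s : ℂ) r ⊆ Uτ Y)
    (lZ : List (TPt d N')) (hlZ : lZ.Nodup ∧ lZ.toFinset = Z.1 \ tclosure L N' (Z0 M t))
    (lD : List (TDom d (L * N'))) (hlD : lD.Nodup ∧ lD.toFinset = t.1)
    -- THE WALK RECORD AT `c⁺` OVER THE PARAMETER SPACE
    (𝒦 : TermKernels ({ c with κ₁ := c.κ₁ + 1 } : B13.Consts) d N' ν Nf B) [Fintype 𝒦.C₀] [DecidableEq 𝒦.C₀]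
    {w : WalkConsts} {α Rσ₀ : ℝ} (hw : w.Admissible α Rσ₀) (hα : 0 < α) (h𝒦 : TermWalkData 𝒦 w)
    -- ITS KERNELS ARE LOCAL FAMILIES (replaces T25's `hAhol hGhol`)
    (A₀ : Matrix 𝒦.Λ 𝒦.Λ ℂ) (H : LocalTerms d N' ν Nf 𝒦.Λ 𝒦.Λ B) (G : LocalTerms d N' ν Nf 𝒦.Λ (𝒦.Λ ⊕ 𝒦.C₀) B)
    (hA2 : ∀ σ b, 𝒦.A2 σ b = A₀ + H.kernel σ b) (hG2 : ∀ σ b, 𝒦.G2 σ b = G.kernel σ b)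
    (Γ : B → (TPt d N' → ℂ) → (𝒦.Λ ⊕ 𝒦.C₀ → ℝ) → (𝒦.Λ → ℂ))
    (hlin : ∀ b ∈ ball (0 : B) α, ∀ σ : TPt d N' → ℂ, (∀ j, σ j ∈ ball (0 : ℂ) (Real.exp (c.κ₁ + 1))) →
      ∀ X : 𝒦.Λ ⊕ 𝒦.C₀ → ℝ, Γ b σ X = 𝒦.G2 σ b *ᵥ fun j => (X j : ℂ))
    (χY₀ χcP : (𝒦.Λ → ℝ) → ℝ) (hχ0 : ∀ Bf, 0 ≤ χY₀ Bf) (hχc0 : ∀ Bf, 0 ≤ χcP Bf) (Dfam : Finset (TDom d (L * N')))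
    (Vk : B → TDom d (L * N') → (𝒦.Λ → ℝ) → ℂ)
    -- NOT walk data and NOT structural: the potentials, measurability, NODE A's symmetry ∕ `Re ≻ 0`
    (hVholb : ∀ Y Bf, DifferentiableOn ℂ (fun b => Vk b Y Bf) (ball (0 : B) α))
    (hχm : Measurable χY₀) (hχcm : Measurable χcP) (hVm : ∀ b ∈ ball (0 : B) α, ∀ Y, Measurable (Vk b Y))
    (hAs : ∀ b : B, ‖b‖ ≤ α → ∀ σ : TPt d N' → ℂ, (∀ j, ‖σ j‖ ≤ Real.exp (c.κ₁ + 1)) → (𝒦.A2 σ b).IsSymm)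
    (hA : ∀ b : B, ‖b‖ ≤ α → ∀ σ : TPt d N' → ℂ, (∀ j, ‖σ j‖ ≤ Real.exp (c.κ₁ + 1)) →
      ((𝒦.A2 σ b).map Complex.re).PosDef)
    -- the (2.22) shape, and (2.20) on the open PER-DOMAIN τ-region, uniform in `b`
    {γ₂ rP a₂₀ w₂₀ : ℝ} (qP : (𝒦.Λ → ℝ) → ℝ)
    (h222 : ∀ Bf, χY₀ Bf * χcP Bf ≤ Real.exp (-(γ₂ / 2 * rP ^ 2 * (t.2.card : ℕ)) + γ₂ / 2 * qP Bf))
    (hγ₂ : 0 ≤ γ₂) (hqP : ∀ Bf, qP Bf ≤ Bf ⬝ᵥ Bf) (ha0 : 0 ≤ a₂₀)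
    (h220U : ∀ b ∈ ball (0 : B) α, ∀ τ : TDom d (L * N') → ℂ, (∀ Y, τ Y ∈ Uτ Y) →
      ∀ Bf, ∑ Y ∈ Dfam, ‖τ Y‖ * ‖Vk b Y Bf‖ ≤ a₂₀ / 2 * (Bf ⬝ᵥ Bf) + w₂₀)
    -- a common fibre bound (rows by the record, columns assumed — located typing point (x10))
    {m : ℕ} (hm : 𝒦.m ≤ m) (hfibN : ∀ x : UT Nf, (Finset.univ.filter fun j => 𝒦.locN j = x).card ≤ m)
    -- rates, NODE A's smallness by name, the remaining numerics in the record's letters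
    {κa κb kap' kap'' θ : ℝ} (hκa : κa < w.kap) (hκb : κb < κa) (h2 : kap' < κb) (h1 : kap'' < kap')
    (hkap'' : 0 < kap'') (hsm : SmallTheta w α θ)
    (hθR1le : (m * (1 + 2 / (κb - kap')) ^ ν) * (m * (1 + 2 / (kap' - kap'')) ^ ν)
      * ((2 * w.KbarΓ * Real.exp (-(w.ε * w.Rσ)) + 2 * w.KbarΓ * α / w.R) * w.KbarC * w.KbarΓ
        + w.KbarΓ * (w.KbarC * (2 * w.KbarE * Real.exp (-(w.ε * w.Rσ)) + 2 * w.KbarE * α / w.R)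
            * (𝒦.m * (1 + 2 / (w.kap - κa)) ^ ν) * w.KbarC * (𝒦.m * (1 + 2 / (κa - κb)) ^ ν)) * w.KbarΓ
        + w.KbarΓ * w.KbarC * (2 * w.KbarΓ * Real.exp (-(w.ε * w.Rσ)) + 2 * w.KbarΓ * α / w.R)) ≤ θ)
    (hsmallKθ : w.KbarC * (m * (1 + 2 / κb) ^ ν) * (θ * (m * (1 + 2 / kap'') ^ ν)) < 1)
    {cE g : ℝ} (hc0 : 0 ≤ cE) (hc : ∀ k, 𝒦.hC.1.eigenvalues k ≤ cE)
    (hαc : (2 * (θ * (m * (1 + 2 / kap'') ^ ν)) + (γ₂ + a₂₀)) * cE ≤ 1 / 2) (hg : 0 ≤ g)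
    (hΓq : ∀ X : 𝒦.Λ ⊕ 𝒦.C₀ → ℝ, (𝒦.Γ₀ *ᵥ X) ⬝ᵥ (𝒦.C *ᵥ (𝒦.Γ₀ *ᵥ X)) ≤ g * (X ⬝ᵥ X))
    (hsmall : (2 * (θ * (m * (1 + 2 / kap'') ^ ν)) + (γ₂ + a₂₀)) * (1 + 2 * cE * g) ≤ 1 / 2)
    {a a₅ : ℝ} (hPa : a ≤ γ₂ * rP ^ 2)
    (hvol : 2 * (w.KbarC * (m * (1 + 2 / κb) ^ ν) * (θ * (m * (1 + 2 / kap'') ^ ν))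
              * (1 + (1 - w.KbarC * (m * (1 + 2 / κb) ^ ν) * (θ * (m * (1 + 2 / kap'') ^ ν)))⁻¹) / 2)
          * (Fintype.card 𝒦.Λ : ℝ)
        + w₂₀ + (2 * (θ * (m * (1 + 2 / kap'') ^ ν)) + (γ₂ + a₂₀)) * cE * (Fintype.card 𝒦.Λ : ℝ)
        + (2 * (θ * (m * (1 + 2 / kap'') ^ ν)) + (γ₂ + a₂₀)) * (1 + 2 * cE * g) * (Fintype.card (𝒦.Λ ⊕ 𝒦.C₀) : ℝ)
        ≤ a₅ * ((Z.1).card : ℝ)) :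
    DifferentiableOn ℂ
        (fun b => term214 r lZ lD (core214 (fun σ => 𝒦.A2 σ b) (Γ b) (F214 t.2.card χY₀ χcP Dfam (Vk b))) 0 0)
        (ball (0 : B) α) ∧
      ∀ b ∈ ball (0 : B) α,
        ‖term214 r lZ lD (core214 (fun σ => 𝒦.A2 σ b) (Γ b) (F214 t.2.card χY₀ χcP Dfam (Vk b))) 0 0‖ ≤
          weight L M c Z a t * Real.exp (a₅ * ((Z.1).card : ℝ)) := by
  -- (i) by §1: the entries of `A₀ + H.kernel σ b` and `G.kernel σ b` are entire in σ
  have hAhol : ∀ b ∈ ball (0 : B) α, ∀ i j,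
      DifferentiableOn ℂ (fun σ => 𝒦.A2 σ b i j) {σ | ∀ j, σ j ∈ ball (0 : ℂ) (Real.exp (c.κ₁ + 1))} := by
    intro b _ i j
    have h : (fun σ => 𝒦.A2 σ b i j) = fun σ => A₀ i j + H.kernel σ b i j :=
      funext fun σ => by rw [hA2]; rfl
    rw [h]
    exact (Differentiable.fun_add (E := TPt d N' → ℂ) (F := ℂ) (differentiable_const _)
      (differentiable_localKernel_sigma H b i j)).differentiableOn
  have hGhol : ∀ b ∈ ball (0 : B) α, ∀ i j,
      DifferentiableOn ℂ (fun σ => 𝒦.G2 σ b i j) {σ | ∀ j, σ j ∈ ball (0 : ℂ) (Real.exp (c.κ₁ + 1))} := by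
    intro b _ i j
    have h : (fun σ => 𝒦.G2 σ b i j) = fun σ => G.kernel σ b i j := funext fun σ => by rw [hG2]
    rw [h]
    exact (differentiable_localKernel_sigma G b i j).differentiableOn
  exact hol_and_h226_torus_of_termWalkData_param c hκ₁ hα₆ Z t hpos hhalf hUτ hUtau hr hr' hsubτ lZ hlZ lD hlD 𝒦 hw hα
    h𝒦 Γ hlin χY₀ χcP hχ0 hχc0 Dfam Vk hAhol hGhol hVholb hχm hχcm hVm hAs hA qP h222 hγ₂ hqP ha0 h220U hm hfibN hκa
    hκb h2 h1 hkap'' hsm hθR1le hsmallKθ hc0 hc hαc hg hΓq hsmall hPa hvol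

end Local

/-! ## §3. NODE O's full model has local-family kernels -/

section Full

variable {d N' : ℕ} {ν : ℕ} {Nf : Fin ν → ℕ} [∀ i, NeZero (Nf i)]
variable {B : Type*} [NormedAddCommGroup B] [NormedSpace ℂ B]

/-- **The full model's record has §2's shape** (by `rfl`): precision `A2 σ b = 1 + H.kernel σ b`, Γ-kernel
`G2 σ b = G.kernel σ b` — so for a full-model term (seam: g1-p2's `FullModelTerm.termWalkData`; NE5's pencil: T19
`TwoRunPencilFullModel.termWalkData_pencil`, both run at `c⁺`) §2 applies with `A₀ = 1` and T25's input (i) is gone.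
[cite: Balaban1988RG2Cluster, (1.11) p.5, p.15] -/
theorem fullModel_kernels_local (c' : B13.Consts) (tm : FullModelTerm d N' ν Nf B)
    (hposH : ((1 : Matrix tm.Λ tm.Λ ℝ) + tm.refH).PosDef) :
    (∀ σ b, (tm.toKernels c' hposH).A2 σ b = (1 : Matrix tm.Λ tm.Λ ℂ) + tm.H.kernel σ b) ∧
      ∀ σ b, (tm.toKernels c' hposH).G2 σ b = tm.G.kernel σ b :=
  ⟨fun _ _ => rfl, fun _ _ => rfl⟩

end Full


/-! ## §4. Beyond local families: σ-holomorphy of a walk SERIES from termwise σ-holomorphy + majorants -/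

section SigmaSeries

variable {d N' : ℕ} [NeZero N'] {ν : ℕ} {Nf : Fin ν → ℕ} [∀ i, NeZero (Nf i)] {p n : Type}
variable {E : Type*}

/-- The open σ-polydisc of radius `r > 0` is the open sup-norm ball of the parameter space. [folklore] -/
theorem sigma_polydisc_eq_ball {r : ℝ} (hr : 0 < r) :
    {σ : TPt d N' → ℂ | ∀ j, σ j ∈ ball (0 : ℂ) r} = ball (0 : TPt d N' → ℂ) r := by
  ext σ
  simp only [Set.mem_setOf_eq, mem_ball_zero_iff]
  exact (pi_norm_lt_iff hr).symm

/-- **σ-HOLOMORPHY OF A WALK SERIES** (the case print is in — [II] p. 5: `H(s(Y₀))X` *"is an analytic function of the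
variables s(Y₀) on the domain |s(Y₀)| ≤ e^{κ₁}"*, an INFINITE convergent sum (1.11) over walks): at a fixed configuration
`u`, if every walk term `σ ↦ T_ω(σ,u)(i,j)` is complex differentiable on the open polydisc of radius `r` (structurally
free: a term carries an `s`-monomial times σ-independent operators), the terms obey the walk majorants
`‖T_ω(σ,u)(i,j)‖ ≤ A_ω e^{−ρD_ω(loc i, loc j)}` uniformly there, the majorant family has `MajSumLe`-bounded partial sums,
and `K(σ,u)(i,j) = Σ_ω T_ω(σ,u)(i,j)` (`HasSum`) there, then `σ ↦ K(σ,u)(i,j)` is complex differentiable on that open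
polydisc — g1-p2's `B13ExpansionAnalytic.differentiableOn_of_hasSum` (Cauchy estimates + `hasFDerivAt_tsum`) on the
sup-norm ball of the parameter space.  This is how T25's input (i) would be DERIVED for Bałaban's family from a
σ-termwise field of the walk record (located typing point (x12): `JointWalkExpansion.termAnalytic` is u-only).
[cite: Balaban1988RG2Cluster, (1.11) p.5, p.13, p.15; Balaban1985BackgroundPropagators, Thm 3.10 p.416] -/
theorem differentiableOn_sigma_of_hasSum (locp : p → UT Nf) (locn : n → UT Nf)
    {K2 : (TPt d N' → ℂ) → E → Matrix p n ℂ} {W : Type} {T2 : W → (TPt d N' → ℂ) → E → Matrix p n ℂ}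
    {A : W → ℝ} {D : W → UT Nf → UT Nf → ℝ} {ρ r : ℝ} {Kbar : UT Nf → UT Nf → ℝ} (hA : ∀ ω, 0 ≤ A ω) (hr : 0 < r)
    (u : E)
    (hK : ∀ σ : TPt d N' → ℂ, (∀ j, σ j ∈ ball (0 : ℂ) r) → ∀ i j, HasSum (fun ω => T2 ω σ u i j) (K2 σ u i j))
    (hTσ : ∀ ω i j, DifferentiableOn ℂ (fun σ => T2 ω σ u i j) {σ : TPt d N' → ℂ | ∀ j, σ j ∈ ball (0 : ℂ) r})
    (hmaj : ∀ ω, ∀ σ : TPt d N' → ℂ, (∀ j, σ j ∈ ball (0 : ℂ) r) →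
      ∀ i j, ‖T2 ω σ u i j‖ ≤ A ω * Real.exp (-(ρ * D ω (locp i) (locn j))))
    (hsum : MajSumLe (g := toB6 (torusGeom Nf 0 0 0) 0 True) (fun ω a b => A ω * Real.exp (-(ρ * D ω a b))) Kbar)
    (i : p) (j : n) :
    DifferentiableOn ℂ (fun σ => K2 σ u i j) {σ : TPt d N' → ℂ | ∀ j, σ j ∈ ball (0 : ℂ) r} := by
  have hset := sigma_polydisc_eq_ball (d := d) (N' := N') hr
  have hmem : ∀ σ : TPt d N' → ℂ, σ ∈ ball (0 : TPt d N' → ℂ) r → ∀ j, σ j ∈ ball (0 : ℂ) r :=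
    fun σ hσ => by rw [← hset] at hσ; exact hσ
  rw [hset]
  have hMs : Summable fun ω => A ω * Real.exp (-(ρ * D ω (locp i) (locn j))) :=
    summable_of_sum_le (fun ω => mul_nonneg (hA ω) (Real.exp_pos _).le) fun Sf => hsum Sf (locp i) (locn j)
  refine differentiableOn_of_hasSum (F := fun ω σ => T2 ω σ u i j) (fun ω => ?_)
    (fun ω σ hσ => hmaj ω σ (hmem σ hσ) i j) hMs (fun σ hσ => hK σ (hmem σ hσ) i j)
  have h := hTσ ω i j
  rwa [hset] at h

end SigmaSeries

end Summit.QuantumFields.BalabanUV.T4Continuum.Spine.NE5.TwoRunTorusWalkFullModel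

end
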